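/-
# Solo-blind programme on Kontsevich–Zagier, s17 (I): rank-`n+2` nilpotent identities behind the
# polylogarithm-ladder certificates — the iterated bracket lemma and corner propagation

Context (paper level, not formalised here; HOME/paper/hodge.md §8.7–8.8).  For algebraic `0 < λ < 1`
the KZ representation `((0,1)ⁿ, λ/(1 − λ x₁⋯xₙ))` has value `Liₙ(λ)`; its cubical symbol realises a
mixed Tate structure of rank `n+1` whose unipotent Mumford–Tate Lie algebra `𝔳⁽ⁿ⁾` is, after a
rational unitriangular change of basis, a GRADED Lie subalgebra of the strictly upper triangular
matrices (graded by the drop `j − i`).  The programme's transcendence certificates reduce to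
`E₀ₙ ∈ 𝔳⁽ⁿ⁾`.  This file kernel-checks, in arbitrary rank over an arbitrary commutative ring, the two
finite-dimensional mechanisms that put the corner unit into a Lie-closed subspace:

* `iterBr_eq_corner` (ITERATED BRACKET LEMMA, hodge.md 8.7(b)): if `A = E₀₁ + (drop ≥ 2)` and
  `B = Σ_{p ≥ 1} ρ_p E_{p,p+1} + (drop ≥ 2)` then `[[…[A,B],B]…,B]` (`n` brackets, rank `n+2`) is
  EXACTLY `(ρ₁ ⋯ ρₙ) • E_{0,n+1}`, whatever the drop ≥ 2 parts are; hence
  `corner_mem_of_lie_closed` (generic `λ`: two `ℚ`-independent Kummer classes).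
* `lie_N1_E0`, `adN1_iter_E0`, `corners_mem_of_N1_E03` (CORNER PROPAGATION, hodge.md 8.8, the case
  `λ = 1/2` where all Kummer classes coincide): with `N₁ = Σ_p E_{p,p+1}`, `[N₁, E₀ₖ] = −E₀,ₖ₊₁`, so a
  Lie-closed subspace containing `N₁` and `E₀₃` contains every `E₀ₖ`, `k ≥ 3`.

The block-rigidity half of the `λ = 1/2` induction step is the companion file `SoloBlindPolylogBlocks`.
No Hodge theory, no periods, no real numbers: pure matrix algebra.
-/
import Mathlib.Data.Matrix.Basic
import Mathlib.Data.Matrix.Mul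
import Mathlib.Algebra.Lie.OfAssociative
import Mathlib.Algebra.BigOperators.Group.Finset.Basic
import Mathlib.Algebra.BigOperators.Intervals
import Mathlib.Tactic.Ring
import Mathlib.Tactic.Linarith
import Mathlib.Tactic.Abel
import HarnessLib

namespace Summit.KontsevichZagierPeriods.KontsevichZagierPeriods.Theorems

namespace SoloBlind

namespace PolylogLadder

open Matrix

variable {K : Type*} [CommRing K] {m : ℕ}

/-! ## Drop filtration on square matrices -/

/-- `Drop d M`: `M` vanishes strictly below the `d`-th superdiagonal (`M i j = 0` unless `j ≥ i + d`). -/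
def Drop (d : ℕ) (M : Matrix (Fin m) (Fin m) K) : Prop :=
  ∀ i j : Fin m, (j : ℕ) < i + d → M i j = 0

/-- The zero matrix has every drop. -/
theorem Drop.zero (d : ℕ) : Drop d (0 : Matrix (Fin m) (Fin m) K) := fun _ _ _ => rfl

/-- `Drop d` is closed under addition. -/
theorem Drop.add {d : ℕ} {M N : Matrix (Fin m) (Fin m) K} (hM : Drop d M) (hN : Drop d N) :
    Drop d (M + N) := by
  intro i j h
  simp [Matrix.add_apply, hM i j h, hN i j h]

/-- `Drop d` is closed under subtraction. -/
theorem Drop.sub {d : ℕ} {M N : Matrix (Fin m) (Fin m) K} (hM : Drop d M) (hN : Drop d N) :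
    Drop d (M - N) := by
  intro i j h
  simp [Matrix.sub_apply, hM i j h, hN i j h]

/-- `Drop d` is closed under scalars. -/
theorem Drop.smul {d : ℕ} {M : Matrix (Fin m) (Fin m) K} (c : K) (hM : Drop d M) :
    Drop d (c • M) := by
  intro i j h
  simp [Matrix.smul_apply, hM i j h]

/-- The drop filtration is decreasing. -/
theorem Drop.mono {d e : ℕ} {M : Matrix (Fin m) (Fin m) K} (h : d ≤ e) (hM : Drop e M) :
    Drop d M := fun i j hij => hM i j (by omega)

/-- Drops add under multiplication. -/
theorem Drop.mul {d e : ℕ} {M N : Matrix (Fin m) (Fin m) K} (hM : Drop d M) (hN : Drop e N) :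
    Drop (d + e) (M * N) := by
  intro i j hij
  rw [Matrix.mul_apply]
  apply Finset.sum_eq_zero
  intro k _
  by_cases hk : (k : ℕ) < i + d
  · rw [hM i k hk, zero_mul]
  · rw [hN k j (by omega), mul_zero]

/-- Drops add under the commutator bracket `⁅M, N⁆ = M N − N M`. -/
theorem Drop.lie {d e : ℕ} {M N : Matrix (Fin m) (Fin m) K} (hM : Drop d M) (hN : Drop e N) :
    Drop (d + e) ⁅M, N⁆ := by
  rw [Ring.lie_def]
  refine Drop.sub (hM.mul hN) ?_
  have h := hN.mul hM
  rwa [Nat.add_comm] at h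

/-- A matrix of full drop is zero. -/
theorem Drop.eq_zero {M : Matrix (Fin m) (Fin m) K} (hM : Drop m M) : M = 0 := by
  ext i j
  exact hM i j (by have := j.isLt; omega)

/-! ## Matrix units and the two nilpotents -/

section defs

variable (K)

/-- The matrix unit `E a b`. -/
def E (a b : Fin m) : Matrix (Fin m) (Fin m) K := fun i j => if i = a ∧ j = b then 1 else 0

/-- `Nsup ρ = Σ_{p ≥ 1} ρ_p E_{p,p+1}`: a superdiagonal matrix with ZERO in row `0` (the drop-1 part of
the coefficient matrix of `log λ / 2πi`). -/
def Nsup (ρ : ℕ → K) : Matrix (Fin m) (Fin m) K :=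
  fun i j => if (j : ℕ) = i + 1 ∧ 1 ≤ (i : ℕ) then ρ i else 0

/-- `N1 = Σ_p E_{p,p+1}`: the full principal nilpotent (all Kummer classes equal, `λ = 1/2`). -/
def N1 : Matrix (Fin m) (Fin m) K := fun i j => if (j : ℕ) = i + 1 then 1 else 0

end defs

/-- Entries of the matrix unit. -/
theorem E_apply (a b i j : Fin m) : (E K a b) i j = if i = a ∧ j = b then 1 else 0 := rfl

/-- Entries of `Nsup ρ`. -/
theorem Nsup_apply (ρ : ℕ → K) (i j : Fin m) :
    (Nsup K ρ : Matrix (Fin m) (Fin m) K) i j =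
      if (j : ℕ) = i + 1 ∧ 1 ≤ (i : ℕ) then ρ i else 0 := rfl

/-- Entries of `N1`. -/
theorem N1_apply (i j : Fin m) : (N1 K : Matrix (Fin m) (Fin m) K) i j =
    if (j : ℕ) = i + 1 then 1 else 0 := rfl

/-- `E a b` has drop `b − a` (any `d ≤ b − a`). -/
theorem Drop_E {a b : Fin m} {d : ℕ} (h : (a : ℕ) + d ≤ b) : Drop d (E K a b) := by
  intro i j hij
  rw [E_apply]
  split_ifs with hab
  · obtain ⟨rfl, rfl⟩ := hab
    omega
  · rfl

/-- `Nsup ρ` has drop `1`. -/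
theorem Drop_Nsup (ρ : ℕ → K) : Drop 1 (Nsup K ρ : Matrix (Fin m) (Fin m) K) := by
  intro i j hij
  rw [Nsup_apply]
  split_ifs with h
  · omega
  · rfl

/-- `N1` has drop `1`. -/
theorem Drop_N1 : Drop 1 (N1 K : Matrix (Fin m) (Fin m) K) := by
  intro i j hij
  rw [N1_apply]
  split_ifs with h
  · omega
  · rfl

section corner

variable {n : ℕ}

local notation "𝕄" => Matrix (Fin (n + 2)) (Fin (n + 2)) K

/-- `E₀ₖ · Nsup ρ = ρ_k E₀,ₖ₊₁` for `k ≥ 1`. -/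
theorem E0_mul_Nsup (ρ : ℕ → K) (k k' : Fin (n + 2)) (hk : 1 ≤ (k : ℕ)) (hk' : (k' : ℕ) = k + 1) :
    (E K 0 k * Nsup K ρ : 𝕄) = ρ k • E K 0 k' := by
  ext i j
  rw [Matrix.mul_apply, Finset.sum_eq_single k]
  · simp only [E_apply, Nsup_apply, Matrix.smul_apply, smul_eq_mul]
    have hjk : (j = k') ↔ ((j : ℕ) = k + 1) := by
      rw [Fin.ext_iff, hk']
    by_cases hi : i = 0 <;> by_cases hj : (j : ℕ) = k + 1 <;> simp [hi, hj, hk, hjk]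
  · intro l _ hl
    simp [E_apply, hl]
  · intro h
    exact absurd (Finset.mem_univ k) h

/-- `Nsup ρ · E₀ₖ = 0` (no superdiagonal unit ends in column `0`). -/
theorem Nsup_mul_E0 (ρ : ℕ → K) (k : Fin (n + 2)) : (Nsup K ρ * E K 0 k : 𝕄) = 0 := by
  ext i j
  rw [Matrix.mul_apply]
  apply Finset.sum_eq_zero
  intro l _
  simp only [Nsup_apply, E_apply]
  split_ifs with h1 h2
  · obtain ⟨rfl, -⟩ := h2
    simp at h1
  · simp
  · simp
  · simp

/-- `[E₀ₖ, Nsup ρ] = ρ_k E₀,ₖ₊₁` for `k ≥ 1`. -/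
theorem lie_E0_Nsup (ρ : ℕ → K) (k k' : Fin (n + 2)) (hk : 1 ≤ (k : ℕ)) (hk' : (k' : ℕ) = k + 1) :
    ⁅(E K 0 k : 𝕄), (Nsup K ρ : 𝕄)⁆ = ρ k • (E K 0 k' : 𝕄) := by
  rw [Ring.lie_def, E0_mul_Nsup ρ k k' hk hk', Nsup_mul_E0, sub_zero]

/-- `E₀ₖ · N₁ = E₀,ₖ₊₁`. -/
theorem E0_mul_N1 (k k' : Fin (n + 2)) (hk' : (k' : ℕ) = k + 1) :
    (E K 0 k * N1 K : 𝕄) = E K 0 k' := by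
  ext i j
  rw [Matrix.mul_apply, Finset.sum_eq_single k]
  · simp only [E_apply, N1_apply]
    have hjk : (j = k') ↔ ((j : ℕ) = k + 1) := by
      rw [Fin.ext_iff, hk']
    by_cases hi : i = 0 <;> by_cases hj : (j : ℕ) = k + 1 <;> simp [hi, hj, hjk]
  · intro l _ hl
    simp [E_apply, hl]
  · intro h
    exact absurd (Finset.mem_univ k) h

/-- `N₁ · E₀ₖ = 0`. -/
theorem N1_mul_E0 (k : Fin (n + 2)) : (N1 K * E K 0 k : 𝕄) = 0 := by
  ext i j
  rw [Matrix.mul_apply]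
  apply Finset.sum_eq_zero
  intro l _
  simp only [N1_apply, E_apply]
  split_ifs with h1 h2
  · obtain ⟨rfl, -⟩ := h2
    simp at h1
  · simp
  · simp
  · simp

/-- CORNER PROPAGATION: `[N₁, E₀ₖ] = −E₀,ₖ₊₁`. -/
theorem lie_N1_E0 (k k' : Fin (n + 2)) (hk' : (k' : ℕ) = k + 1) :
    ⁅(N1 K : 𝕄), (E K 0 k : 𝕄)⁆ = -(E K 0 k' : 𝕄) := by
  rw [Ring.lie_def, N1_mul_E0, E0_mul_N1 k k' hk', zero_sub]

/-! ## The iterated bracket lemma (hodge.md 8.7(b)) -/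

/-- `iterBr A B k = [[…[A,B],B]…,B]` (`k` brackets). -/
def iterBr (A B : Matrix (Fin m) (Fin m) K) : ℕ → Matrix (Fin m) (Fin m) K
  | 0 => A
  | k + 1 => ⁅iterBr A B k, B⁆

/-- No bracket: `A`. -/
theorem iterBr_zero (A B : Matrix (Fin m) (Fin m) K) : iterBr A B 0 = A := rfl

/-- One more bracket with `B`. -/
theorem iterBr_succ (A B : Matrix (Fin m) (Fin m) K) (k : ℕ) :
    iterBr A B (k + 1) = ⁅iterBr A B k, B⁆ := rfl

/-- Shape of the `k`-fold bracket: `(ρ₁⋯ρ_k) E₀,ₖ₊₁ + (drop ≥ k+2)`, for `k ≤ n` in rank `n+2`. -/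
theorem iterBr_shape (ρ : ℕ → K) (A B : 𝕄)
    (hA : Drop 2 (A - E K 0 (⟨1, by omega⟩ : Fin (n + 2))))
    (hB : Drop 2 (B - Nsup K ρ)) (k : ℕ) (hk : k ≤ n) :
    Drop (k + 2) (iterBr A B k -
      (∏ p ∈ Finset.range k, ρ (p + 1)) • E K 0 (⟨k + 1, by omega⟩ : Fin (n + 2))) := by
  induction k with
  | zero =>
    simpa [iterBr_zero] using hA
  | succ k ih =>
    have hR := ih (by omega)
    set T : 𝕄 := iterBr A B k with hT
    set c : K := ∏ p ∈ Finset.range k, ρ (p + 1) with hc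
    have hEN : ⁅(E K 0 (⟨k + 1, by omega⟩ : Fin (n + 2)) : 𝕄), (Nsup K ρ : 𝕄)⁆ =
        ρ (k + 1) • (E K 0 (⟨k + 1 + 1, by omega⟩ : Fin (n + 2)) : 𝕄) :=
      lie_E0_Nsup ρ ⟨k + 1, by omega⟩ ⟨k + 1 + 1, by omega⟩
        (by show 1 ≤ k + 1; omega) rfl
    have hprod : (∏ p ∈ Finset.range (k + 1), ρ (p + 1)) = c * ρ (k + 1) := by
      rw [hc, Finset.prod_range_succ]
    have key : iterBr A B (k + 1) -
        (∏ p ∈ Finset.range (k + 1), ρ (p + 1)) • E K 0 (⟨k + 1 + 1, by omega⟩ : Fin (n + 2))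
        = c • ⁅(E K 0 (⟨k + 1, by omega⟩ : Fin (n + 2)) : 𝕄), B - Nsup K ρ⁆
          + ⁅T - c • E K 0 (⟨k + 1, by omega⟩ : Fin (n + 2)), (Nsup K ρ : 𝕄)⁆
          + ⁅T - c • E K 0 (⟨k + 1, by omega⟩ : Fin (n + 2)), B - Nsup K ρ⁆ := by
      rw [iterBr_succ, ← hT, hprod, ← smul_smul, ← hEN]
      simp only [Ring.lie_def, mul_sub, sub_mul, smul_sub, smul_mul_assoc, mul_smul_comm]
      abel
    rw [key]
    have h1 : Drop (k + 1 + 2)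
        (c • ⁅(E K 0 (⟨k + 1, by omega⟩ : Fin (n + 2)) : 𝕄), B - Nsup K ρ⁆) := by
      have hE : Drop (k + 1) (E K (0 : Fin (n + 2)) (⟨k + 1, by omega⟩ : Fin (n + 2))) :=
        Drop_E (by simp only [Fin.val_zero]; omega)
      exact Drop.smul c (hE.lie hB)
    have h2 : Drop (k + 1 + 2)
        ⁅T - c • E K 0 (⟨k + 1, by omega⟩ : Fin (n + 2)), (Nsup K ρ : 𝕄)⁆ :=
      Drop.mono (by omega) (hR.lie (Drop_Nsup ρ))
    have h3 : Drop (k + 1 + 2)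
        ⁅T - c • E K 0 (⟨k + 1, by omega⟩ : Fin (n + 2)), B - Nsup K ρ⁆ :=
      Drop.mono (by omega) (hR.lie hB)
    exact (h1.add h2).add h3

/-- ITERATED BRACKET LEMMA (all ranks).  In rank `n + 2`, if `A = E₀₁ + (drop ≥ 2)` and
`B = Σ_{p≥1} ρ_p E_{p,p+1} + (drop ≥ 2)`, then the `n`-fold bracket `[[…[A,B],B]…,B]` equals
`(ρ₁ ⋯ ρₙ) • E_{0,n+1}` on the nose. -/
theorem iterBr_eq_corner (ρ : ℕ → K) (A B : 𝕄)
    (hA : Drop 2 (A - E K 0 (⟨1, by omega⟩ : Fin (n + 2)))) (hB : Drop 2 (B - Nsup K ρ)) :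
    iterBr A B n = (∏ p ∈ Finset.range n, ρ (p + 1)) • E K 0 (Fin.last (n + 1)) := by
  have h := (iterBr_shape ρ A B hA hB n le_rfl).eq_zero
  exact sub_eq_zero.mp h

/-- Membership form: a Lie-closed subspace containing such `A, B` (all `ρ_p ≠ 0`) contains the
corner `E_{0,n+1}` (`𝔳⁽ⁿ⁺¹⁾ ∋ E₀,ₙ₊₁`, hodge.md 8.7(c)). -/
theorem corner_mem_of_lie_closed {F : Type*} [Field F] (ρ : ℕ → F)
    (L : Submodule F (Matrix (Fin (n + 2)) (Fin (n + 2)) F))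
    (hL : ∀ X Y : Matrix (Fin (n + 2)) (Fin (n + 2)) F, X ∈ L → Y ∈ L → ⁅X, Y⁆ ∈ L)
    (A B : Matrix (Fin (n + 2)) (Fin (n + 2)) F) (hAL : A ∈ L) (hBL : B ∈ L)
    (hA : Drop 2 (A - E F 0 (⟨1, by omega⟩ : Fin (n + 2)))) (hB : Drop 2 (B - Nsup F ρ))
    (hρ : ∀ p ∈ Finset.range n, ρ (p + 1) ≠ 0) :
    E F 0 (Fin.last (n + 1)) ∈ L := by
  have hmem : ∀ k, iterBr A B k ∈ L := by
    intro k
    induction k with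
    | zero => simpa [iterBr_zero] using hAL
    | succ k ih => rw [iterBr_succ]; exact hL _ _ ih hBL
  have hne : (∏ p ∈ Finset.range n, ρ (p + 1)) ≠ 0 := Finset.prod_ne_zero_iff.mpr hρ
  have h := L.smul_mem (∏ p ∈ Finset.range n, ρ (p + 1))⁻¹ (hmem n)
  rw [iterBr_eq_corner ρ A B hA hB, smul_smul, inv_mul_cancel₀ hne, one_smul] at h
  exact h

/-! ## Corner propagation at `λ = 1/2` (hodge.md 8.8) -/

/-- `ad(N₁)ʲ E₀,ₖ = (−1)ʲ E₀,ₖ₊ⱼ`: iterating `[N₁, ·]` walks the corner units along the top row. -/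
theorem adN1_iter_E0 (k j : ℕ) (h : k + j < n + 2) :
    (fun M : 𝕄 => ⁅(N1 K : 𝕄), M⁆)^[j] (E K 0 (⟨k, by omega⟩ : Fin (n + 2)))
      = (-1 : K) ^ j • (E K 0 (⟨k + j, h⟩ : Fin (n + 2)) : 𝕄) := by
  induction j with
  | zero =>
    rw [Function.iterate_zero_apply, pow_zero, one_smul]
    rfl
  | succ j ih =>
    rw [Function.iterate_succ_apply', ih (by omega), Ring.lie_def, mul_smul_comm, smul_mul_assoc,
      N1_mul_E0, E0_mul_N1 (⟨k + j, by omega⟩ : Fin (n + 2)) ⟨k + (j + 1), h⟩ rfl,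
      smul_zero, zero_sub, pow_succ, mul_neg_one, neg_smul]

/-- Membership form: a Lie-closed subspace containing `N₁` and `E₀₃` contains every corner unit
`E₀ₖ`, `3 ≤ k ≤ n+1`. -/
theorem corners_mem_of_N1_E03 (L : Submodule K 𝕄)
    (hL : ∀ X Y : 𝕄, X ∈ L → Y ∈ L → ⁅X, Y⁆ ∈ L)
    (hN : (N1 K : 𝕄) ∈ L) (h3 : 3 < n + 2)
    (hE : (E K 0 (⟨3, h3⟩ : Fin (n + 2)) : 𝕄) ∈ L) (k : ℕ) (hk3 : 3 ≤ k) (hk : k < n + 2) :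
    (E K 0 (⟨k, hk⟩ : Fin (n + 2)) : 𝕄) ∈ L := by
  have hiter : ∀ j : ℕ, ∀ h : 3 + j < n + 2, (E K 0 (⟨3 + j, h⟩ : Fin (n + 2)) : 𝕄) ∈ L := by
    intro j
    induction j with
    | zero => intro h; exact hE
    | succ j ih =>
      intro h
      have h' := hL _ _ hN (ih (by omega))
      rw [lie_N1_E0 (⟨3 + j, by omega⟩ : Fin (n + 2)) ⟨3 + (j + 1), h⟩ rfl] at h'
      simpa using L.neg_mem h'
  obtain ⟨j, rfl⟩ : ∃ j, k = 3 + j := ⟨k - 3, by omega⟩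
  exact hiter j hk

end corner

end PolylogLadder

end SoloBlind

end Summit.KontsevichZagierPeriods.KontsevichZagierPeriods.Theorems
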